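import Mathlib
import Summits.NavierStokesRegularity.NavierStokesRegularity.Theorems.TaoLadderRungTwoBreakBlowupRigidityOneDampedWindowClosure
import Summits.NavierStokesRegularity.NavierStokesRegularity.Theorems.TaoLadderRungTwoBreakBlowupRigidityOneTypeIEternalLimit
import HarnessLib

/-!
# THE TYPE-II BRANCH: a DOMINATING SEQUENCE of the renormalised flow (its values run off to infinity along
  `(n_j, σ_j)` while dominating the past and a short future) yields, by SUP-RESCALING, a NON-TRIVIAL BOUNDED ANCIENT
  SOLUTION of the AUTONOMOUS lattice `V' = Q(V) + Λ A(V_{·-1}) + Λ⁻¹ B(V_{·+1}, V)` — the complement of the type-I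
  extraction for K2(1) `BlowupRigidityOne` (stmt-NavierStokesRegularity-20206) / `stub_typeOne` of K2ᵛ(1) ⟨20420⟩

MODEL lattice ODEs only (Tao 2016 §4 (4.8)/(4.12), §6.4); nothing here is a statement about the Navier–Stokes equations;
NO item is closed (`--supports stmt-NavierStokesRegularity-20206`). Route-independent; general `m`.

If the renormalisation `W̃` of an exact flow is NOT uniformly bounded (type I fails), point-picking produces a DOMINATING
SEQUENCE: `M_j = ‖W̃_{n_j}(σ_j)‖ → ∞` with `‖W̃_n(σ)‖ ≤ 2 M_j` for all shells and all log-times `σ ≤ σ_j + 1/M_j` of the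
half-line (the selection itself is not in this file). The SUP-RESCALED translates `g_j(n, s) = M_j⁻¹ W̃_{n+n_j}(σ_j + s/M_j)`
then solve the lattice law with DAMPING `1/M_j → 0` (degree-two homogeneity of `Q, A, B`: `tableQ_smul`, `tableA_smul`,
`tableB_smul_smul`) on the windows `(a_j, 1]`, `a_j = -(σ_j + log T) M_j → -∞`, are bounded by `2` there with
`‖g_j(0,0)‖ = 1`; Arzelà–Ascoli (on the extension constant beyond `s = 1`) and `dampedLaw_of_continuousLimit_window`
(`c_∞ = 0`) give:

* `rescaled_law` — the damped law of the sup-rescaled translates;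
* `ancientLimit_of_dominatingSequence` — **∃ V : ℤ → ℝ → ℝ^m solving the AUTONOMOUS lattice law at every `s < 1`, with
  `‖V_n(s)‖ ≤ 2` for `s ≤ 1` and `‖V_0(0)‖ = 1`** (a non-trivial bounded ancient solution of the exact cascade in the critical
  variables `y_n = Λ^n x_n`).

HONEST LABEL: conditional on the dominating sequence (the point-picking lemma «¬ type I ⇒ dominating sequence» and the
Liouville question for such ancient solutions are open here); no stub, crux or summit is proved.
-/

noncomputable section

-- the summit and its single sub-problem share the name (CONVENTIONS §1)
set_option linter.dupNamespace false

open Set Filter Topology MeasureTheory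

namespace Summit.NavierStokesRegularity.NavierStokesRegularity.Theorems

namespace BlowupRigidityOne

open Literature.Analysis.FluidPDE Literature.Analysis.FluidPDE.TaoCascade
open Summit.NavierStokesRegularity.NavierStokesRegularity.Cruxes.MinimalBlowupExtraction.Extraction
  (exists_subseq_continuousLimit)
open WakeRatchetCritical (tableQ_smul tableA_smul tableB_smul_smul)

variable {m : ℕ}

/-- **THE SUP-RESCALED TRANSLATES SOLVE THE DAMPED LAW.** For the renormalisation `W̃` of an exact flow on `[0,T)` and
`M > 0`, the rescaled translate `g(n, s) = M⁻¹ • W̃_{n+n₀}(σ₀ + s/M)` satisfies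
`g' = -(M⁻¹ • g) + Q(g) + Λ A(g(·-1)) + Λ⁻¹ B(g(·+1), g)` at every `s` with `e^{-(σ₀ + s/M)} < T`
(chain rule + degree-two homogeneity of the structure maps). [cite: Tao2016AveragedNS, §4 (4.8), (4.12), §6.4; cell vocabulary] -/
theorem rescaled_law {ε₀ T M σ₀ : ℝ} (hε : 0 < ε₀) {α : Fin m → Fin m → Fin m → ℤ × ℤ × ℤ → ℝ}
    {X : Fin m → ℤ → ℝ → ℝ} (hC1 : ∀ i n, ContDiffOn ℝ 1 (X i n) (Set.Ico 0 T))
    (hmot : ∀ i n t, 0 ≤ t → t < T → derivWithin (X i n) (Set.Ici 0) t = quadTerm ε₀ α X i n t)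
    {W : ℤ → ℝ → Em m}
    (hW : ∀ n σ, W n σ = (bigLam ε₀ ^ n * Real.exp (-σ)) • shellVec X n (T - Real.exp (-σ)))
    (hM : 0 < M) (n₀ n : ℤ) {s : ℝ} (hs : Real.exp (-(σ₀ + s / M)) < T) :
    HasDerivAt (fun u => M⁻¹ • W (n + n₀) (σ₀ + u / M))
      (-(M⁻¹ • (M⁻¹ • W (n + n₀) (σ₀ + s / M))) + tableQ α (M⁻¹ • W (n + n₀) (σ₀ + s / M))
        + bigLam ε₀ • tableA α (M⁻¹ • W (n - 1 + n₀) (σ₀ + s / M))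
        + (bigLam ε₀)⁻¹ • tableB α (M⁻¹ • W (n + 1 + n₀) (σ₀ + s / M)) (M⁻¹ • W (n + n₀) (σ₀ + s / M))) s := by
  have hMne : M ≠ 0 := hM.ne'
  -- the law at the point, composed with the affine clock `u ↦ σ₀ + u/M`
  have hlaw := renormalisedFlow_law hε hC1 hmot hW (n + n₀) hs
  have haff : HasDerivAt (fun u : ℝ => σ₀ + u / M) (1 / M) s := by
    have h := ((hasDerivAt_id s).div_const M).const_add σ₀
    simpa using h
  have hcomp := (hlaw.scomp s haff).const_smul M⁻¹
  have e1 : n + n₀ - 1 = n - 1 + n₀ := by ring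
  have e2 : n + n₀ + 1 = n + 1 + n₀ := by ring
  rw [e1, e2] at hcomp
  -- homogeneity: rewrite the field in terms of `g = M⁻¹ • W̃`
  have key : M⁻¹ • ((1 / M) • (-((1 : ℝ) • W (n + n₀) (σ₀ + s / M)) + tableQ α (W (n + n₀) (σ₀ + s / M))
      + bigLam ε₀ • tableA α (W (n - 1 + n₀) (σ₀ + s / M))
      + (bigLam ε₀)⁻¹ • tableB α (W (n + 1 + n₀) (σ₀ + s / M)) (W (n + n₀) (σ₀ + s / M)))) =
      -(M⁻¹ • (M⁻¹ • W (n + n₀) (σ₀ + s / M))) + tableQ α (M⁻¹ • W (n + n₀) (σ₀ + s / M))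
        + bigLam ε₀ • tableA α (M⁻¹ • W (n - 1 + n₀) (σ₀ + s / M))
        + (bigLam ε₀)⁻¹ • tableB α (M⁻¹ • W (n + 1 + n₀) (σ₀ + s / M)) (M⁻¹ • W (n + n₀) (σ₀ + s / M)) := by
    rw [tableQ_smul, tableA_smul, tableB_smul_smul, one_smul, one_div]
    simp only [smul_add, smul_neg, smul_smul]
    have e3 : M⁻¹ * (M⁻¹ * bigLam ε₀) = bigLam ε₀ * M⁻¹ ^ 2 := by ring
    have e4 : M⁻¹ * (M⁻¹ * (bigLam ε₀)⁻¹) = (bigLam ε₀)⁻¹ * M⁻¹ ^ 2 := by ring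
    have e5 : M⁻¹ * M⁻¹ = M⁻¹ ^ 2 := by ring
    rw [e3, e4, e5]
  rw [key] at hcomp
  exact hcomp

/-- **A DOMINATING SEQUENCE YIELDS A NON-TRIVIAL BOUNDED ANCIENT SOLUTION OF THE AUTONOMOUS LATTICE.** Let `X` be an
exact flow on `[0,T)` with renormalisation `W̃`, and let `(n_j, σ_j, R_j)` be a DOMINATING SEQUENCE (the output of
point-picking): `M_j := ‖W̃_{n_j}(σ_j)‖ → +∞`, `R_j → +∞`, the log-time window `[σ_j - R_j/M_j, σ_j + 1/M_j]` lies in the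
flow's half-line, and `‖W̃_n(σ)‖ ≤ 2 M_j` for every shell `n` and every `σ` in that window. Then there is `V : ℤ → ℝ → ℝ^m` — a continuous limit of the sup-rescaled
translates `M_j⁻¹ W̃_{n+n_j}(σ_j + s/M_j)` — solving the AUTONOMOUS lattice law
`V' = Q(V) + Λ A(V(·-1)) + Λ⁻¹ B(V(·+1), V)` at every `s < 1`, bounded `‖V_n(s)‖ ≤ 2` for `s ≤ 1`, and NON-TRIVIAL:
`‖V_0(0)‖ = 1`. (The type-II branch: if type I fails for a robust blow-up, point-picking supplies such a sequence.)
[cite: Tao2016AveragedNS, §4 Thm. 4.2 (statement shape), (4.8), §6.4; KochNadirashviliSereginSverak2009, Thm 1.1 ff. (rescaling shape); Teschl2012, §2.6; cell vocabulary] -/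
theorem ancientLimit_of_dominatingSequence {ε₀ T : ℝ} (hε : 0 < ε₀)
    {α : Fin m → Fin m → Fin m → ℤ × ℤ × ℤ → ℝ}
    {X : Fin m → ℤ → ℝ → ℝ} (hC1 : ∀ i n, ContDiffOn ℝ 1 (X i n) (Set.Ico 0 T))
    (hmot : ∀ i n t, 0 ≤ t → t < T → derivWithin (X i n) (Set.Ici 0) t = quadTerm ε₀ α X i n t)
    {W : ℤ → ℝ → Em m}
    (hW : ∀ n σ, W n σ = (bigLam ε₀ ^ n * Real.exp (-σ)) • shellVec X n (T - Real.exp (-σ)))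
    (nseq : ℕ → ℤ) (σseq : ℕ → ℝ) (R : ℕ → ℝ) (hR : Tendsto R atTop atTop)
    (hMinf : Tendsto (fun j => ‖W (nseq j) (σseq j)‖) atTop atTop)
    (hin : ∀ j : ℕ, Real.exp (-(σseq j - R j / ‖W (nseq j) (σseq j)‖)) < T)
    (hdom : ∀ (j : ℕ) (n : ℤ) (σ : ℝ), σseq j - R j / ‖W (nseq j) (σseq j)‖ ≤ σ →
      σ ≤ σseq j + 1 / ‖W (nseq j) (σseq j)‖ → ‖W n σ‖ ≤ 2 * ‖W (nseq j) (σseq j)‖) :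
    ∃ V : ℤ → ℝ → Em m,
      (∀ (n : ℤ) (s : ℝ), s < 1 → HasDerivAt (V n) (tableQ α (V n s) + bigLam ε₀ • tableA α (V (n - 1) s)
        + (bigLam ε₀)⁻¹ • tableB α (V (n + 1) s) (V n s)) s) ∧
      (∀ (n : ℤ) (s : ℝ), s ≤ 1 → ‖V n s‖ ≤ 2) ∧ ‖V 0 0‖ = 1 := by
  -- wlog `M_j ≥ 1` for all `j` (pass to a tail): we simply work eventually
  set M : ℕ → ℝ := fun j => ‖W (nseq j) (σseq j)‖ with hM_def
  have hMev : ∀ᶠ j in atTop, 1 ≤ M j := hMinf.eventually (eventually_ge_atTop 1)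
  -- windows in rescaled time: `s > a_j := -R_j` keeps `σ_j + s/M_j` inside the dominated window and the half-line
  set av : ℕ → ℝ := fun j => -R j with hav_def
  have hlowσ : ∀ (j : ℕ) (s : ℝ), 1 ≤ M j → av j < s → σseq j - R j / M j ≤ σseq j + s / M j := by
    intro j s hMj hs
    have hMj0 : 0 < M j := by linarith
    have : -R j < s := hs
    have h1 : -R j / M j ≤ s / M j := div_le_div_of_nonneg_right this.le hMj0.le
    have h2 : -R j / M j = -(R j / M j) := neg_div _ _
    linarith
  have hwin : ∀ (j : ℕ) (s : ℝ), 1 ≤ M j → av j < s → Real.exp (-(σseq j + s / M j)) < T := by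
    intro j s hMj hs
    exact lt_of_le_of_lt (Real.exp_le_exp.2 (by linarith [hlowσ j s hMj hs])) (hin j)
  have hav : Tendsto av atTop atBot := tendsto_neg_atTop_atBot.comp hR
  -- the rescaled translates and their constant extension beyond `s = 1`
  set g : ℕ → ℤ → ℝ → Em m := fun j n s => (M j)⁻¹ • W (n + nseq j) (σseq j + s / M j) with hg_def
  set gh : ℕ → ℤ → ℝ → Em m := fun j n s => g j n (min s 1) with hgh_def
  -- bound `2` on the window `(a_j, 1]`
  have hgb : ∀ (j : ℕ) (n : ℤ) (s : ℝ), 1 ≤ M j → av j < s → s ≤ 1 → ‖g j n s‖ ≤ 2 := by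
    intro j n s hMj hs hs1
    have hMj0 : 0 < M j := by linarith
    have h := hdom j (n + nseq j) (σseq j + s / M j) (hlowσ j s hMj hs) (by
      have : s / M j ≤ 1 / M j := div_le_div_of_nonneg_right hs1 hMj0.le
      linarith)
    show ‖(M j)⁻¹ • W (n + nseq j) (σseq j + s / M j)‖ ≤ 2
    rw [norm_smul, Real.norm_of_nonneg (inv_pos.2 hMj0).le, inv_mul_le_iff₀ hMj0]
    linarith
  -- the damped law of `g j` on the window (damping `1/M_j`)
  have hlawg : ∀ (j : ℕ) (n : ℤ) (s : ℝ), 1 ≤ M j → av j < s → HasDerivAt (g j n)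
      (-((M j)⁻¹ • g j n s) + tableQ α (g j n s) + bigLam ε₀ • tableA α (g j (n - 1) s)
        + (bigLam ε₀)⁻¹ • tableB α (g j (n + 1) s) (g j n s)) s := by
    intro j n s hMj hs
    exact rescaled_law hε hC1 hmot hW (by linarith) (nseq j) n (hwin j s hMj hs)
  -- Lipschitz on `[a', 1]` eventually, with a constant depending on `a'` only through the window
  have hfield : ∀ (j : ℕ) (n : ℤ) (s : ℝ), 1 ≤ M j → av j < s → s ≤ 1 →
      ‖-((M j)⁻¹ • g j n s) + tableQ α (g j n s) + bigLam ε₀ • tableA α (g j (n - 1) s)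
        + (bigLam ε₀)⁻¹ • tableB α (g j (n + 1) s) (g j n s)‖ ≤
      2 + (2 + shiftConst α (0, 0, 0) * 2 ^ 2 + ‖bigLam ε₀‖ * (shiftConst α (0, 0, 1) * 2 ^ 2)
        + ‖(bigLam ε₀)⁻¹‖ * ((shiftConst α (1, 0, 0) + shiftConst α (0, 1, 0)) * 2 * 2)) := by
    intro j n s hMj hs hs1
    have hMj0 : 0 < M j := by linarith
    have hx := hgb j n s hMj hs hs1
    have hrhs := norm_eternalLaw_rhs_le ε₀ α zero_le_two hx (hgb j (n - 1) s hMj hs hs1) (hgb j (n + 1) s hMj hs hs1)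
    have e : -((M j)⁻¹ • g j n s) + tableQ α (g j n s) + bigLam ε₀ • tableA α (g j (n - 1) s)
        + (bigLam ε₀)⁻¹ • tableB α (g j (n + 1) s) (g j n s) =
        (-((1 : ℝ) • g j n s) + tableQ α (g j n s) + bigLam ε₀ • tableA α (g j (n - 1) s)
          + (bigLam ε₀)⁻¹ • tableB α (g j (n + 1) s) (g j n s)) + (1 - (M j)⁻¹) • g j n s := by
      rw [sub_smul, one_smul]; abel
    rw [e]
    have hd : ‖(1 - (M j)⁻¹) • g j n s‖ ≤ 2 := by
      rw [norm_smul, Real.norm_eq_abs]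
      have h1 : |1 - (M j)⁻¹| ≤ 1 := by
        have hi0 : 0 ≤ (M j)⁻¹ := (inv_pos.2 hMj0).le
        have hi1 : (M j)⁻¹ ≤ 1 := inv_le_one_of_one_le₀ hMj
        rw [abs_le]; constructor <;> linarith
      calc |1 - (M j)⁻¹| * ‖g j n s‖ ≤ 1 * 2 := mul_le_mul h1 hx (norm_nonneg _) zero_le_one
        _ = 2 := one_mul _
    calc _ ≤ ‖-((1 : ℝ) • g j n s) + tableQ α (g j n s) + bigLam ε₀ • tableA α (g j (n - 1) s)
          + (bigLam ε₀)⁻¹ • tableB α (g j (n + 1) s) (g j n s)‖ + ‖(1 - (M j)⁻¹) • g j n s‖ := norm_add_le _ _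
      _ ≤ _ := by linarith [hrhs, hd]
  set K : ℝ := 2 + (2 + shiftConst α (0, 0, 0) * 2 ^ 2 + ‖bigLam ε₀‖ * (shiftConst α (0, 0, 1) * 2 ^ 2)
      + ‖(bigLam ε₀)⁻¹‖ * ((shiftConst α (1, 0, 0) + shiftConst α (0, 1, 0)) * 2 * 2)) with hK_def
  have hlipg : ∀ (j : ℕ) (n : ℤ) (u v : ℝ), 1 ≤ M j → av j < u → u ≤ v → v ≤ 1 →
      ‖g j n v - g j n u‖ ≤ K * (v - u) := by
    intro j n u v hMj hu huv hv1
    have hderiv : ∀ τ ∈ Icc u v, HasDerivWithinAt (g j n)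
        (-((M j)⁻¹ • g j n τ) + tableQ α (g j n τ) + bigLam ε₀ • tableA α (g j (n - 1) τ)
          + (bigLam ε₀)⁻¹ • tableB α (g j (n + 1) τ) (g j n τ)) (Icc u v) τ := fun τ hτ =>
      (hlawg j n τ hMj (by linarith [hτ.1])).hasDerivWithinAt
    have hbound : ∀ τ ∈ Ico u v,
        ‖-((M j)⁻¹ • g j n τ) + tableQ α (g j n τ) + bigLam ε₀ • tableA α (g j (n - 1) τ)
          + (bigLam ε₀)⁻¹ • tableB α (g j (n + 1) τ) (g j n τ)‖ ≤ K := fun τ hτ =>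
      hfield j n τ hMj (by linarith [hτ.1]) (by linarith [hτ.2])
    exact norm_image_sub_le_of_norm_deriv_le_segment' hderiv hbound v (right_mem_Icc.2 huv)
  -- Arzelà–Ascoli for the extensions `gh`
  have hJ : ∀ a' : ℝ, ∃ J : ℕ, ∀ j, J ≤ j → av j < a' ∧ 1 ≤ M j := fun a' =>
    eventually_atTop.1 ((hav.eventually (eventually_lt_atBot a')).and hMev)
  have hghb : ∀ (j : ℕ) (n : ℤ) (a' u : ℝ), 1 ≤ M j → av j < min a' 1 → a' ≤ u → ‖gh j n u‖ ≤ 2 := by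
    intro j n a' u hMj hja hu
    show ‖g j n (min u 1)‖ ≤ 2
    exact hgb j n (min u 1) hMj (lt_of_lt_of_le hja (min_le_min_right 1 hu)) (min_le_right _ _)
  have hAB : ∀ (n : ℤ) (a' : ℝ), ∃ C' : ℝ, ∃ J : ℕ, ∀ j, J ≤ j → ∀ u : ℝ, a' ≤ u → ‖gh j n u‖ ≤ C' := by
    intro n a'
    obtain ⟨J, hJ'⟩ := hJ (min a' 1)
    exact ⟨2, J, fun j hj u hu => hghb j n a' u (hJ' j hj).2 (hJ' j hj).1 hu⟩
  have hAL : ∀ (n : ℤ) (a' : ℝ), ∃ K' : ℝ, ∃ J : ℕ, ∀ j, J ≤ j → ∀ u v : ℝ, a' ≤ u → a' ≤ v →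
      ‖gh j n u - gh j n v‖ ≤ K' * |u - v| := by
    intro n a'
    obtain ⟨J, hJ'⟩ := hJ (min a' 1)
    refine ⟨K, J, fun j hj u v hu hv => ?_⟩
    have hK0 : 0 ≤ K := by
      have := hfield j n (min u 1) (hJ' j hj).2 (lt_of_lt_of_le (hJ' j hj).1 (min_le_min_right 1 hu)) (min_le_right _ _)
      exact (norm_nonneg _).trans this
    have hmin : |min u 1 - min v 1| ≤ |u - v| := by
      have h := abs_min_sub_min_le_max u 1 v 1
      rwa [sub_self, abs_zero, max_eq_left (abs_nonneg _)] at h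
    have hcore : ∀ p q : ℝ, a' ≤ p → p ≤ q → ‖gh j n q - gh j n p‖ ≤ K * (min q 1 - min p 1) := by
      intro p q hp hpq
      show ‖g j n (min q 1) - g j n (min p 1)‖ ≤ K * (min q 1 - min p 1)
      exact hlipg j n (min p 1) (min q 1) (hJ' j hj).2
        (lt_of_lt_of_le (hJ' j hj).1 (min_le_min_right 1 hp)) (min_le_min_right 1 hpq) (min_le_right _ _)
    rcases le_total u v with huv | hvu
    · rw [norm_sub_rev]
      calc ‖gh j n v - gh j n u‖ ≤ K * (min v 1 - min u 1) := hcore u v hu huv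
        _ ≤ K * |u - v| := by
            refine mul_le_mul_of_nonneg_left ?_ hK0
            calc min v 1 - min u 1 ≤ |min u 1 - min v 1| := by rw [abs_sub_comm]; exact le_abs_self _
              _ ≤ |u - v| := hmin
    · calc ‖gh j n u - gh j n v‖ ≤ K * (min u 1 - min v 1) := hcore v u hv hvu
        _ ≤ K * |u - v| := by
            refine mul_le_mul_of_nonneg_left ?_ hK0
            exact (le_abs_self _).trans hmin
  obtain ⟨φ, hφ, V, hconv⟩ := exists_subseq_continuousLimit gh hAB hAL
  -- below `1` the extensions agree with the rescaled translates, eventually along any `u_j → σ < 1`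
  have hconvg : ∀ (n : ℤ) (u : ℕ → ℝ) (σ : ℝ), σ < 1 → Tendsto u atTop (𝓝 σ) →
      Tendsto (fun j => g (φ j) n (u j)) atTop (𝓝 (V n σ)) := by
    intro n u σ hσ1 hu
    have hev : ∀ᶠ j in atTop, u j < 1 := hu.eventually (eventually_lt_nhds hσ1)
    refine (hconv n u σ hu).congr' (hev.mono fun j hj => ?_)
    show g (φ j) n (min (u j) 1) = g (φ j) n (u j)
    rw [min_eq_left hj.le]
  -- the limit solves the AUTONOMOUS law below `1`
  have hav' : Tendsto (fun j => av (φ j)) atTop atBot := hav.comp hφ.tendsto_atTop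
  have hMev' : ∀ᶠ j in atTop, 1 ≤ M (φ j) := hφ.tendsto_atTop.eventually hMev
  have hc : Tendsto (fun j => (M (φ j))⁻¹) atTop (𝓝 0) :=
    tendsto_inv_atTop_zero.comp (hMinf.comp hφ.tendsto_atTop)
  -- re-index so that the law holds for ALL j on the window: use `a'_j := if 1 ≤ M_j then a_j else 1` trick via max
  set av2 : ℕ → ℝ := fun j => if 1 ≤ M (φ j) then av (φ j) else 1 with hav2_def
  have hav2 : Tendsto av2 atTop atBot := by
    refine hav'.congr' (hMev'.mono fun j hj => ?_)
    show av (φ j) = av2 j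
    rw [hav2_def]; simp [hj]
  have hlaw2 : ∀ (j : ℕ) (n : ℤ) (u : ℝ), av2 j < u → u < 1 → HasDerivAt (g (φ j) n)
      (-((M (φ j))⁻¹ • g (φ j) n u) + tableQ α (g (φ j) n u) + bigLam ε₀ • tableA α (g (φ j) (n - 1) u)
        + (bigLam ε₀)⁻¹ • tableB α (g (φ j) (n + 1) u) (g (φ j) n u)) u := by
    intro j n u hu hu1
    by_cases hMj : 1 ≤ M (φ j)
    · have : av (φ j) < u := by rw [hav2_def] at hu; simpa [hMj] using hu
      exact hlawg (φ j) n u hMj this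
    · exfalso
      have : (1 : ℝ) < u := by rw [hav2_def] at hu; simpa [hMj] using hu
      linarith
  have hbd2 : ∀ (n : ℤ) (a' : ℝ), ∃ B : ℝ, ∀ᶠ j in atTop, ∀ u : ℝ, a' ≤ u → u < 1 → ‖g (φ j) n u‖ ≤ B := by
    intro n a'
    refine ⟨2, ?_⟩
    filter_upwards [hav'.eventually (eventually_lt_atBot a'), hMev'] with j hja hMj u hu hu1
    exact hgb (φ j) n u hMj (lt_of_lt_of_le hja hu) hu1.le
  have hlawV : ∀ (n : ℤ) (s : ℝ), s < 1 → HasDerivAt (V n) (tableQ α (V n s) + bigLam ε₀ • tableA α (V (n - 1) s)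
      + (bigLam ε₀)⁻¹ • tableB α (V (n + 1) s) (V n s)) s := by
    intro n s hs
    have h := dampedLaw_of_continuousLimit_window (V := fun j => g (φ j)) (c := fun j => (M (φ j))⁻¹)
      (cinf := 0) hlaw2 hbd2 hav2 hc hconvg n hs
    simpa only [zero_smul, neg_zero, zero_add] using h
  -- bound `2` for `s ≤ 1` and the normalisation `‖V 0 0‖ = 1`
  have hbdV : ∀ (n : ℤ) (s : ℝ), s ≤ 1 → ‖V n s‖ ≤ 2 := by
    intro n s hs
    have ht := (hconv n (fun _ => s) s tendsto_const_nhds).norm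
    refine le_of_tendsto ht ?_
    filter_upwards [hav'.eventually (eventually_lt_atBot (min s 1)), hMev'] with j hja hMj
    exact hghb (φ j) n s s hMj hja le_rfl
  have hnorm1 : ‖V 0 0‖ = 1 := by
    have ht := (hconv 0 (fun _ => (0 : ℝ)) 0 tendsto_const_nhds).norm
    have hev : ∀ᶠ j in atTop, ‖gh (φ j) 0 0‖ = 1 := by
      refine hMev'.mono fun j hMj => ?_
      have hMj0 : 0 < M (φ j) := by linarith
      show ‖g (φ j) 0 (min 0 1)‖ = 1
      rw [min_eq_left zero_le_one]
      show ‖(M (φ j))⁻¹ • W (0 + nseq (φ j)) (σseq (φ j) + 0 / M (φ j))‖ = 1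
      rw [zero_add, zero_div, add_zero, norm_smul, Real.norm_of_nonneg (inv_pos.2 hMj0).le]
      exact inv_mul_cancel₀ hMj0.ne'
    exact tendsto_nhds_unique ht (tendsto_const_nhds.congr' (hev.mono fun j hj => hj.symm))
  exact ⟨V, hlawV, hbdV, hnorm1⟩

end BlowupRigidityOne

end Summit.NavierStokesRegularity.NavierStokesRegularity.Theorems

end
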